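/-
Copyright (c) 2026. All rights reserved.
Released under Apache 2.0 license as described in the file LICENSE.
-/
import Literature.AlgebraicGeometry.Pohlmann1968.MultiquadraticCMFieldIndexTwoCMSubfields
import Literature.AlgebraicGeometry.Pohlmann1968.MultiquadraticCMFieldTwistIntersections
import Literature.NumberTheory.ComplexMultiplication.DegenerateCMTypesElementaryAbelianPartiallyBentTypesCensus
import HarnessLib

/-!
# Multiquadratic CM fields of degree `64`: EXACTLY `65 536 = 2¹⁶` CM types `Φ` all of whose Galois twists meet `Φ` in
# `0`, `16` or `32` embeddings (the partially-bent types — Hodge conjecture for all powers of their abelian varieties);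
# the subfields of a multiquadratic field counted by Gaussian binomials (Chebolu–Lockridge Thm. 4.1)

SETTING (tree `MultiquadraticCMFieldTwistIntersections`, `MultiquadraticCMFieldPartiallyBentTypesSubfield`,
`MultiquadraticCMFieldIndexTwoCMSubfields`, `DegenerateCMTypesElementaryAbelianPartiallyBentTypesCensus`).  `K` a
multiquadratic CM field (`K/ℚ` Galois, `Gal(K/ℚ)` of exponent `2`, `ρ` = complex conjugation), `g = [K:ℚ]/2`, `Φσ`
the Galois twist of a CM type `Φ` by `σ ∈ Gal(K/ℚ)` (tree `inducedCMType σ⁻¹`), `Stab(Φ) = {σ : Φσ = Φ}` (tree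
`twistStabilizer`; `K^{Stab(Φ)}` is the reflex-type field, G. Shimura [Shimura1998] §8.2 Prop. 26).  `Φ` is
PARTIALLY-BENT when `|Φ ∩ Φσ| ∈ {0, g/2, g}` for every `σ` (tree `partiallyBent_iff_forall_ncard_inter`:
C. Carlet's partially-bent Boolean functions [Carlet2020] §6.2.1 Prop. 94 / Def. 62 in the twist dictionary); such `Φ`
attain Shimura's reflex bound, so `Bᵐ(A) = Dᵐ(A)` for all `m` and THE HODGE CONJECTURE HOLDS FOR EVERY POWER of every
abelian variety `A` of type `(K; Φ)` (tree `hodgeConjectureFor_pow_of_forall_ncard_inter`).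

THE PRINT.  S. K. Chebolu, K. Lockridge [CheboluLockridge2022] §4 **Theorem 4.1** (held `paper:arxiv-2108.10956`
chunk p0007): «Let `L/K` be a Galois extension such that `Gal(L/K)` is a finite `p`-group of rank `n` … [the
intermediate fields are counted by] `binom{n}{k}_p`» (Galois correspondence from their Thm. 2.2 / Lemma 3.2 —
tree `GroupTheory/FiniteAbelian/ElementaryAbelianSubgroupCount`); T. Kubota [Kubota1965] §2: a subfield of a CM field
is totally real or CM, CM iff complex conjugation acts non-trivially; the group-level census of partially-bent types
(tree `PartiallyBentTypesCensus.card_filter_partiallyBent_of_card_eq_sixtyFour`: `65 536` on the group of order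
`64`, by stabiliser `32 · 2 + 1240 · 8 + 62 · 896`).  THIS FILE is the FIELD DRESS:

> **Theorem** (`ncard_finrank_mul_eq_not_isTotallyReal`, §1).  **A multiquadratic CM field of degree `2^{n+1}` has
> EXACTLY `2ᵈ·[n; d]_2` CM subfields `F` with `[K:F] = 2ᵈ`** (and `[n+1; d]_2` subfields with `[K:F] = 2ᵈ` in all,
> `ncard_finrank_mul_eq` — Chebolu–Lockridge Thm. 4.1); degree `64`: `62 · 620 · 1240 · 496 · 32` CM subfields of
> degree `32 · 16 · 8 · 4 · 2` (`ncard_not_isTotallyReal_of_finrank_eq_sixtyFour`), `1395` subfields of degree `8` in all.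
> **Theorem** (`ncard_partiallyBent_of_finrank_eq_sixtyFour`, §2).  **A multiquadratic CM field of degree `64` has
> EXACTLY `65 536 = 2¹⁶` CM types `Φ` with `|Φ ∩ Φσ| ∈ {0, 16, 32}` for every `σ ∈ Gal(K/ℚ)`** (of `2³²` CM types);
> by the order of the stabiliser (`ncard_partiallyBent_natCard_twistStabilizer_of_finrank_eq_sixtyFour`): `64` with
> `|Stab(Φ)| = 32` (reflex-type field imaginary quadratic), `9 920` with `|Stab(Φ)| = 8` (reflex-type field one of the
> `1240` CM subfields of degree `8`, each carrying exactly `8`, tree `ncard_partiallyBent_twistStabilizer_eq_of_finrank_eq_eight`),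
> `55 552` with `|Stab(Φ)| = 2` (the imprimitive near-bent types, tree).  Degrees `32`, `16`: `2048`, `128`; degree `8`:
> ALL `16` CM types (`forall_partiallyBent_of_finrank_eq_eight`).
> **Corollary** (`le_ncard_forall_hodgeConjectureFor_pow_of_finrank_eq_sixtyFour`, §3).  **At least `65 536` of the
> `2³²` CM types of a degree-`64` multiquadratic CM field have the property that every abelian variety of that type
> satisfies the Hodge conjecture together with all its powers.**

HONEST SCOPE.  Transport of the tree's group-level census along `Φ ↦ T_Φ` (tree `ncard_cmType_sep_eq`) and of the
Gaussian-binomial subgroup counts along the Galois correspondence `H ↦ K^H`; the figures are the tree's arithmetic on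
N. Tokareva's `|𝓑₂| = 8`, `|𝓑₄| = 896` [Tokareva2015BentFunctions] §7.1, not printed numbers.  The `2³² − 2¹⁶`
remaining CM types of degree `64` are NOT claimed to violate `B = D` (among PLATEAUED types they do, tree
`forall_hodgeClassSpan_eq_iff_forall_ncard_inter`; in general the question is the type's rank).  THEOREMS ONLY: no
definition, no named fact, no instance, no `sorry`.

## References

* [CheboluLockridge2022] S. K. Chebolu, K. Lockridge, *Gaussian Binomial Coefficients in Group Theory, Field Theory,
  and Topology*, Amer. Math. Monthly 129 (2022) — §4 Theorem 4.1 (intermediate fields), §2 Theorem 2.2.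
* [Carlet2020] C. Carlet, *Boolean Functions for Cryptography and Coding Theory*, CUP (2020), §6.2.1 Proposition 94,
  Definition 62.
* [Tokareva2015BentFunctions] N. Tokareva, *Bent Functions*, Academic Press (2015), §7.1 (`|𝓑₂| = 8`, `|𝓑₄| = 896`).
* [Kubota1965] T. Kubota, *On the field extension by complex multiplication*, Trans. AMS 118 (1965), §2.
* [MilneFT2022] J. S. Milne, *Fields and Galois Theory*, Thm. 3.16 (Galois correspondence, `[E^H : F] = (G : H)`).
* [Shimura1998] G. Shimura, *Abelian Varieties with Complex Multiplication and Modular Functions*, §8.2 Prop. 26,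
  §8.4 Example (1).
* [Gordon1999HodgeAVSurvey] B. B. Gordon, *A survey of the Hodge conjecture for abelian varieties*, Thm. 6.4, §9.3.
* [Pohlmann1968] H. Pohlmann, *Algebraic cycles on abelian varieties of complex multiplication type*, Ann. of Math. 88
  (1968), Thm. 1.

## Provenance

Lane `lit-hodgefound` (Track 2, Layer A3/A5 field dress), seat `lit-hodgefound-p10` generation 45, row g45-#3;
neighbours cited by name, nothing restated: `DegenerateCMTypesElementaryAbelianPartiallyBentTypesCensus` (g45-#2:
`card_filter_partiallyBent_of_card_eq_sixtyFour/thirtyTwo/sixteen`, `card_filter_partiallyBent_card_stabilizer_of_card_eq_sixtyFour`,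
`forall_partiallyBent_of_card_eq_eight`, USED), `GroupTheory/FiniteAbelian/ElementaryAbelianSubgroupCount` (g45-#1:
`natCard_subgroup_eq_qBinomial`, `natCard_subgroup_not_mem_eq`, `card_filter_not_mem_of_card_eq_sixtyFour`,
`card_filter_eight_of_card_eq_sixtyFour`, USED), `MultiquadraticCMFieldTwistIntersections` (g43-#12:
`partiallyBent_iff_forall_ncard_inter`, `hodgeConjectureFor_pow_of_forall_ncard_inter`, USED),
`MultiquadraticCMFieldIndexTwoCMSubfields` (g44-#6: `fixedField_injective`, the index-`2` template, USED),
`DegenerateCMTypesCyclicCMFieldPrimeSquare` (`ncard_cmType_sep_eq`), `AbelianCMFieldStabilizerCharacterCriterion`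
(`natCard_twistStabilizer_eq_card_stabilizer`), `CosetGermGaloisSetting` (`CMNumbers.index_fixingSubgroup_eq_finrank`,
`conjGal_not_mem_fixingSubgroup_iff`), `SimpleDegenerateCMAbelianVarietiesCompositeDimension` (`card_gal_eq_finrank`,
`conjGalElt_ne_one`), `NondegenerateCMTypeExistenceAbelianField` (`apply_conjGal_eq`).
-/

open scoped BigOperators NumberField IsMulCommutative Classical
open NumberField Module CategoryTheory CategoryTheory.Limits IntermediateField

namespace Literature.AlgebraicGeometry.Pohlmann1968

namespace MultiquadraticPartiallyBentCensus

open scoped Literature.NumberTheory.ComplexMultiplication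
open Literature.NumberTheory.ComplexMultiplication (twistStabilizer IsCMTypeWith conjGal inducedCMType)
open Literature.NumberTheory.ComplexMultiplication.CMNumbers (index_fixingSubgroup_eq_finrank conjGal_not_mem_fixingSubgroup_iff)
open Literature.NumberTheory.ComplexMultiplication.CyclicCMType.ExponentTwo.PartiallyBentTypesCensus
  (card_filter_partiallyBent_of_card_eq_sixtyFour card_filter_partiallyBent_of_card_eq_thirtyTwo
   card_filter_partiallyBent_of_card_eq_sixteen card_filter_partiallyBent_card_stabilizer_of_card_eq_sixtyFour
   forall_partiallyBent_of_card_eq_eight)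
open Literature.GroupTheory.FiniteAbelian.ElementaryAbelianSubgroupCount (natCard_subgroup_eq_qBinomial
  natCard_subgroup_not_mem_eq card_filter_not_mem_of_card_eq_sixtyFour card_filter_eight_of_card_eq_sixtyFour)
open Literature.AlgebraicGeometry.Pohlmann1968.MultiquadraticIndexTwoSubfields (fixedField_injective)
open Literature.AlgebraicGeometry.Pohlmann1968.MultiquadraticTwistIntersections (partiallyBent_iff_forall_ncard_inter
  hodgeConjectureFor_pow_of_forall_ncard_inter)
open Literature.Combinatorics.Enumerative (qBinomial)
open Literature.AlgebraicGeometry.Motives (CMType AbelianVariety)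
open Literature.AlgebraicGeometry.HodgeTheory
open Literature.AlgebraicGeometry.ComplexMultiplication (IsCMTypeRealisation)

variable {K : Type} [Field K] [NumberField K] [IsCMField K] [IsGalois ℚ K]

/-! ## §0 Helpers -/

section Helpers

omit [IsGalois ℚ K] in
/-- `φ₀ ∘ ρ = conj ∘ φ₀`. [cite: Shimura1998, §18.2 Lemma (i)] -/
private theorem apply_conjGal_eq_pc (φ₀ : K →+* ℂ) (x : K) :
    φ₀ ((conjGal : K ≃ₐ[ℚ] K) x) = starRingEnd ℂ (φ₀ x) :=
  AbelianCMFieldExistence.apply_conjGal_eq φ₀ x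

omit [IsCMField K] in
/-- `|Gal(K/ℚ)| = [K:ℚ]` (as `Nat.card`). [cite: MilneFT2022, Thm. 3.16] -/
private theorem natCard_gal_eq_finrank_pc : Nat.card (K ≃ₐ[ℚ] K) = finrank ℚ K := by
  obtain ⟨φ₀⟩ := (inferInstance : Nonempty (K →+* ℂ))
  rw [Nat.card_eq_fintype_card, card_gal_eq_finrank φ₀]

/-- `ρ ∉ H ⟺ K^H` is not totally real. [cite: Kubota1965, §2] -/
private theorem conjGal_not_mem_iff_pc (H : Subgroup (K ≃ₐ[ℚ] K)) :
    (conjGal : K ≃ₐ[ℚ] K) ∉ H ↔ ¬ IsTotallyReal (fixedField H) := by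
  rw [← conjGal_not_mem_fixingSubgroup_iff (fixedField H), fixingSubgroup_fixedField]

/-- Transport of a count of CM types with a condition on `T_Φ` to the Galois group (tree `ncard_cmType_sep_eq`).
[cite: Shimura1998, §8.1] -/
private theorem ncard_eq_card_filter_pc (hexp : ∀ g : K ≃ₐ[ℚ] K, g ^ 2 = 1) (φ₀ : K →+* ℂ)
    (Q : Finset (K ≃ₐ[ℚ] K) → Prop) :
    {Φ : CMType K | Q (Finset.univ.filter fun s : K ≃ₐ[ℚ] K => embOf φ₀ s ∈ Φ.1)}.ncard =
      ((Finset.univ : Finset (Finset (K ≃ₐ[ℚ] K))).filter fun T : Finset (K ≃ₐ[ℚ] K) =>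
        IsCMTypeWith (conjGal : K ≃ₐ[ℚ] K) (T : Set (K ≃ₐ[ℚ] K)) ∧ Q T).card := by
  haveI := Multiquadratic.isAbelianGalois_of_forall_sq_eq_one hexp
  rw [CyclicPrimeSquare.ncard_cmType_sep_eq (apply_conjGal_eq_pc φ₀) _ Q (fun Φ => Iff.rfl)]
  have hset : {ΦG : Finset (K ≃ₐ[ℚ] K) | IsCMTypeWith (conjGal : K ≃ₐ[ℚ] K) (ΦG : Set (K ≃ₐ[ℚ] K)) ∧ Q ΦG} =
      ↑((Finset.univ : Finset (Finset (K ≃ₐ[ℚ] K))).filter fun T : Finset (K ≃ₐ[ℚ] K) =>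
        IsCMTypeWith (conjGal : K ≃ₐ[ℚ] K) (T : Set (K ≃ₐ[ℚ] K)) ∧ Q T) := by
    ext T
    simp only [Set.mem_setOf_eq, Finset.coe_filter, Finset.mem_univ, true_and]
  rw [hset, Set.ncard_coe_finset]

/-- The same with a condition on `|Stab(Φ)|` (tree `natCard_twistStabilizer_eq_card_stabilizer`).
[cite: Shimura1998, §8.1 and §8.4 Example (1)] -/
private theorem ncard_eq_card_filter_stab_pc (hexp : ∀ g : K ≃ₐ[ℚ] K, g ^ 2 = 1) (φ₀ : K →+* ℂ)
    (Q : Finset (K ≃ₐ[ℚ] K) → Prop) (n : ℕ) :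
    {Φ : CMType K | Q (Finset.univ.filter fun s : K ≃ₐ[ℚ] K => embOf φ₀ s ∈ Φ.1) ∧
        Nat.card (twistStabilizer Φ) = n}.ncard =
      ((Finset.univ : Finset (Finset (K ≃ₐ[ℚ] K))).filter fun T : Finset (K ≃ₐ[ℚ] K) =>
        IsCMTypeWith (conjGal : K ≃ₐ[ℚ] K) (T : Set (K ≃ₐ[ℚ] K)) ∧ Q T ∧
          (Finset.univ.filter fun g : K ≃ₐ[ℚ] K => ∀ t : K ≃ₐ[ℚ] K, t * g ∈ T ↔ t ∈ T).card = n).card := by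
  haveI := Multiquadratic.isAbelianGalois_of_forall_sq_eq_one hexp
  rw [CyclicPrimeSquare.ncard_cmType_sep_eq (apply_conjGal_eq_pc φ₀) _
    (fun T : Finset (K ≃ₐ[ℚ] K) => Q T ∧
      (Finset.univ.filter fun g : K ≃ₐ[ℚ] K => ∀ t : K ≃ₐ[ℚ] K, t * g ∈ T ↔ t ∈ T).card = n)
    (fun Φ => by rw [natCard_twistStabilizer_eq_card_stabilizer φ₀ Φ])]
  have hset : {ΦG : Finset (K ≃ₐ[ℚ] K) | IsCMTypeWith (conjGal : K ≃ₐ[ℚ] K) (ΦG : Set (K ≃ₐ[ℚ] K)) ∧ Q ΦG ∧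
      (Finset.univ.filter fun g : K ≃ₐ[ℚ] K => ∀ t : K ≃ₐ[ℚ] K, t * g ∈ ΦG ↔ t ∈ ΦG).card = n} =
      ↑((Finset.univ : Finset (Finset (K ≃ₐ[ℚ] K))).filter fun T : Finset (K ≃ₐ[ℚ] K) =>
        IsCMTypeWith (conjGal : K ≃ₐ[ℚ] K) (T : Set (K ≃ₐ[ℚ] K)) ∧ Q T ∧
          (Finset.univ.filter fun g : K ≃ₐ[ℚ] K => ∀ t : K ≃ₐ[ℚ] K, t * g ∈ T ↔ t ∈ T).card = n) := by
    ext T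
    simp only [Set.mem_setOf_eq, Finset.coe_filter, Finset.mem_univ, true_and]
  rw [hset, Set.ncard_coe_finset]

omit [IsCMField K] [IsGalois ℚ K] in
/-- `CMType K` is finite. [folklore] -/
private theorem finite_cmType_pc : Finite (CMType K) := by
  unfold CMType
  infer_instance

end Helpers

/-! ## §1 The subfields of a multiquadratic (CM) field counted by Gaussian binomials -/

section Subfields

omit [IsCMField K] in
/-- **`|Gal(K/F)| = m ⟺ m·[F:ℚ] = [K:ℚ]`** (`|Gal(K/F)|·[F:ℚ] = [K:ℚ]`). [cite: MilneFT2022, Thm. 3.16] -/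
theorem natCard_fixingSubgroup_eq_iff (F : IntermediateField ℚ K) (m : ℕ) :
    Nat.card F.fixingSubgroup = m ↔ m * finrank ℚ F = finrank ℚ K := by
  have h1 := F.fixingSubgroup.card_mul_index
  rw [index_fixingSubgroup_eq_finrank F, natCard_gal_eq_finrank_pc] at h1
  have hF : 0 < finrank ℚ F := finrank_pos
  constructor
  · intro h2
    rw [← h1, h2]
  · intro h2
    rw [← h2] at h1
    exact Nat.eq_of_mul_eq_mul_right hF h1

omit [IsCMField K] in
/-- **THE SUBFIELDS `F` WITH `[K:F] = m` ARE THE `K^H`, `|H| = m`** (Galois correspondence).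
[cite: MilneFT2022, Thm. 3.16] [cite: CheboluLockridge2022, §4 Theorem 4.1] -/
theorem setOf_mul_finrank_eq_eq_image (m : ℕ) :
    {F : IntermediateField ℚ K | m * finrank ℚ F = finrank ℚ K} =
      (fun H : Subgroup (K ≃ₐ[ℚ] K) => fixedField H) '' {H : Subgroup (K ≃ₐ[ℚ] K) | Nat.card H = m} := by
  ext F
  simp only [Set.mem_setOf_eq, Set.mem_image]
  constructor
  · intro h2
    exact ⟨F.fixingSubgroup, (natCard_fixingSubgroup_eq_iff F m).2 h2, IsGalois.fixedField_fixingSubgroup F⟩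
  · rintro ⟨H, hH, rfl⟩
    rw [← natCard_fixingSubgroup_eq_iff (fixedField H) m, fixingSubgroup_fixedField]
    exact hH

/-- **THE CM SUBFIELDS `F` WITH `[K:F] = m` ARE THE `K^H`, `|H| = m`, `ρ ∉ H`** (a subfield of a CM field is CM iff
not totally real iff complex conjugation does not fix it). [cite: MilneFT2022, Thm. 3.16] [cite: Kubota1965, §2] -/
theorem setOf_mul_finrank_eq_not_isTotallyReal_eq_image (m : ℕ) :
    {F : IntermediateField ℚ K | m * finrank ℚ F = finrank ℚ K ∧ ¬ IsTotallyReal F} =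
      (fun H : Subgroup (K ≃ₐ[ℚ] K) => fixedField H) ''
        {H : Subgroup (K ≃ₐ[ℚ] K) | Nat.card H = m ∧ (conjGal : K ≃ₐ[ℚ] K) ∉ H} := by
  ext F
  simp only [Set.mem_setOf_eq, Set.mem_image]
  constructor
  · rintro ⟨h2, hF⟩
    exact ⟨F.fixingSubgroup, ⟨(natCard_fixingSubgroup_eq_iff F m).2 h2, (conjGal_not_mem_fixingSubgroup_iff F).2 hF⟩,
      IsGalois.fixedField_fixingSubgroup F⟩
  · rintro ⟨H, ⟨hH, hρH⟩, rfl⟩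
    refine ⟨?_, (conjGal_not_mem_iff_pc H).1 hρH⟩
    rw [← natCard_fixingSubgroup_eq_iff (fixedField H) m, fixingSubgroup_fixedField]
    exact hH

omit [IsCMField K] in
/-- **CHEBOLU–LOCKRIDGE THEOREM 4.1 FOR A MULTIQUADRATIC FIELD: a Galois field `K` of degree `2ⁿ` with `Gal(K/ℚ)` of
exponent `2` has EXACTLY `[n; d]_2` subfields `F` with `[K:F] = 2ᵈ`** (`= [n; n−d]_2` of degree `2ᵈ`).
[cite: CheboluLockridge2022, §4 Theorem 4.1] [cite: MilneFT2022, Thm. 3.16] -/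
theorem ncard_finrank_mul_eq (hexp : ∀ g : K ≃ₐ[ℚ] K, g ^ 2 = 1) {n : ℕ} (hK : finrank ℚ K = 2 ^ n) (d : ℕ) :
    ({F : IntermediateField ℚ K | 2 ^ d * finrank ℚ F = finrank ℚ K}.ncard : ℤ) = qBinomial (2 : ℤ) n d := by
  haveI := Multiquadratic.isAbelianGalois_of_forall_sq_eq_one hexp
  have hG : Nat.card (K ≃ₐ[ℚ] K) = 2 ^ n := by rw [natCard_gal_eq_finrank_pc, hK]
  have h := natCard_subgroup_eq_qBinomial (G := K ≃ₐ[ℚ] K) (p := 2) hexp hG d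
  have e : Nat.card {H : Subgroup (K ≃ₐ[ℚ] K) // Nat.card H = 2 ^ d} =
      {F : IntermediateField ℚ K | 2 ^ d * finrank ℚ F = finrank ℚ K}.ncard := by
    rw [setOf_mul_finrank_eq_eq_image (2 ^ d),
      Set.ncard_image_of_injective _ fixedField_injective, ← Nat.card_coe_set_eq]
    rfl
  rw [← e]
  exact h

/-- **A MULTIQUADRATIC CM FIELD OF DEGREE `2^{n+1}` HAS EXACTLY `2ᵈ·[n; d]_2` CM SUBFIELDS `F` WITH `[K:F] = 2ᵈ`**
(the subgroups of order `2ᵈ` avoiding `ρ`; the other `[n; d−1]_2` subfields of that index are totally real).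
[cite: CheboluLockridge2022, §4 Theorem 4.1 and §2 Theorem 2.2] [cite: Kubota1965, §2] [cite: MilneFT2022, Thm. 3.16] -/
theorem ncard_finrank_mul_eq_not_isTotallyReal (hexp : ∀ g : K ≃ₐ[ℚ] K, g ^ 2 = 1) {n : ℕ}
    (hK : finrank ℚ K = 2 ^ (n + 1)) (d : ℕ) :
    ({F : IntermediateField ℚ K | 2 ^ d * finrank ℚ F = finrank ℚ K ∧ ¬ IsTotallyReal F}.ncard : ℤ) =
      (2 : ℤ) ^ d * qBinomial (2 : ℤ) n d := by
  haveI := Multiquadratic.isAbelianGalois_of_forall_sq_eq_one hexp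
  obtain ⟨φ₀⟩ := (inferInstance : Nonempty (K →+* ℂ))
  have hG : Nat.card (K ≃ₐ[ℚ] K) = 2 ^ (n + 1) := by rw [natCard_gal_eq_finrank_pc, hK]
  have h := natCard_subgroup_not_mem_eq (G := K ≃ₐ[ℚ] K) (p := 2) hexp hG
    (conjGalElt_ne_one (apply_conjGal_eq_pc φ₀)) d
  have e : Nat.card {H : Subgroup (K ≃ₐ[ℚ] K) // Nat.card H = 2 ^ d ∧ (conjGal : K ≃ₐ[ℚ] K) ∉ H} =
      {F : IntermediateField ℚ K | 2 ^ d * finrank ℚ F = finrank ℚ K ∧ ¬ IsTotallyReal F}.ncard := by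
    rw [setOf_mul_finrank_eq_not_isTotallyReal_eq_image (2 ^ d),
      Set.ncard_image_of_injective _ fixedField_injective, ← Nat.card_coe_set_eq]
    rfl
  rw [← e]
  exact h

/-- Numeric engine: `#{F : [F:ℚ] = e, F not totally real} = N` on a multiquadratic CM field of degree `D = m·e` from
the group-level count `#{H : |H| = m, ρ ∉ H} = N`. [cite: MilneFT2022, Thm. 3.16] [cite: Kubota1965, §2] -/
private theorem ncard_finrank_eq_not_isTotallyReal_of_card {D m e N : ℕ} (hK : finrank ℚ K = D)
    (hm : 0 < m) (hme : m * e = D)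
    (hN : ((Finset.univ : Finset (Subgroup (K ≃ₐ[ℚ] K))).filter fun H : Subgroup (K ≃ₐ[ℚ] K) =>
      Nat.card H = m ∧ (conjGal : K ≃ₐ[ℚ] K) ∉ H).card = N) :
    {F : IntermediateField ℚ K | finrank ℚ F = e ∧ ¬ IsTotallyReal F}.ncard = N := by
  have hset : {F : IntermediateField ℚ K | finrank ℚ F = e ∧ ¬ IsTotallyReal F} =
      {F : IntermediateField ℚ K | m * finrank ℚ F = finrank ℚ K ∧ ¬ IsTotallyReal F} := by
    ext F
    simp only [Set.mem_setOf_eq, hK]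
    refine and_congr_left' ⟨fun h1 => by rw [h1, hme], fun h1 => ?_⟩
    rw [← hme] at h1
    exact Nat.eq_of_mul_eq_mul_left hm h1
  rw [hset, setOf_mul_finrank_eq_not_isTotallyReal_eq_image m, Set.ncard_image_of_injective _ fixedField_injective,
    ← hN, ← Set.ncard_coe_finset]
  congr 1
  ext H
  simp only [Set.mem_setOf_eq, Finset.coe_filter, Finset.mem_univ, true_and]

/-- **DEGREE `64`: EXACTLY `620` CM SUBFIELDS OF DEGREE `16`, `1240` OF DEGREE `8`, `496` OF DEGREE `4`, `32` OF
DEGREE `2`** (imaginary quadratic) — the subgroups of order `4, 8, 16, 32` of `Gal(K/ℚ) ≅ (ℤ/2)⁶` avoiding `ρ`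
(`4·155`, `8·155`, `16·31`, `32·1`); with the tree's `62` CM subfields of degree `32`
(`MultiquadraticIndexTwoSubfields.ncard_eq_sixtyTwo_of_finrank_eq_sixtyFour`) and `K` itself, `2451` CM subfields in
all. [cite: CheboluLockridge2022, §4 Theorem 4.1] [cite: Kubota1965, §2] [cite: MilneFT2022, Thm. 3.16] -/
theorem ncard_not_isTotallyReal_of_finrank_eq_sixtyFour (hexp : ∀ g : K ≃ₐ[ℚ] K, g ^ 2 = 1) (hK : finrank ℚ K = 64) :
    {F : IntermediateField ℚ K | finrank ℚ F = 16 ∧ ¬ IsTotallyReal F}.ncard = 620 ∧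
      {F : IntermediateField ℚ K | finrank ℚ F = 8 ∧ ¬ IsTotallyReal F}.ncard = 1240 ∧
      {F : IntermediateField ℚ K | finrank ℚ F = 4 ∧ ¬ IsTotallyReal F}.ncard = 496 ∧
      {F : IntermediateField ℚ K | finrank ℚ F = 2 ∧ ¬ IsTotallyReal F}.ncard = 32 := by
  obtain ⟨φ₀⟩ := (inferInstance : Nonempty (K →+* ℂ))
  haveI := Multiquadratic.isAbelianGalois_of_forall_sq_eq_one hexp
  have h64 : Fintype.card (K ≃ₐ[ℚ] K) = 64 := by rw [card_gal_eq_finrank φ₀, hK]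
  obtain ⟨-, h4, h8, h16, h32⟩ := card_filter_not_mem_of_card_eq_sixtyFour hexp h64
    (conjGalElt_ne_one (apply_conjGal_eq_pc φ₀))
  exact ⟨ncard_finrank_eq_not_isTotallyReal_of_card hK (by norm_num) (by norm_num) h4,
    ncard_finrank_eq_not_isTotallyReal_of_card hK (by norm_num) (by norm_num) h8,
    ncard_finrank_eq_not_isTotallyReal_of_card hK (by norm_num) (by norm_num) h16,
    ncard_finrank_eq_not_isTotallyReal_of_card hK (by norm_num) (by norm_num) h32⟩

omit [IsCMField K] in
/-- **DEGREE `64`: EXACTLY `1395 = [6; 3]_2` SUBFIELDS OF DEGREE `8`** of a multiquadratic field of degree `64` (CM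
or not). [cite: CheboluLockridge2022, §4 Theorem 4.1] [cite: MilneFT2022, Thm. 3.16] -/
theorem ncard_finrank_eq_eight_of_finrank_eq_sixtyFour (hexp : ∀ g : K ≃ₐ[ℚ] K, g ^ 2 = 1) (hK : finrank ℚ K = 64) :
    {F : IntermediateField ℚ K | finrank ℚ F = 8}.ncard = 1395 := by
  have h := ncard_finrank_mul_eq hexp (n := 6) (by rw [hK]; norm_num) 3
  have e : qBinomial (2 : ℤ) 6 3 = 1395 := by norm_num [qBinomial]
  have hset : {F : IntermediateField ℚ K | finrank ℚ F = 8} =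
      {F : IntermediateField ℚ K | 2 ^ 3 * finrank ℚ F = finrank ℚ K} := by
    ext F
    simp only [Set.mem_setOf_eq, hK]
    constructor
    · intro h1; rw [h1]; norm_num
    · intro h1; omega
  rw [hset]
  rw [e] at h
  exact_mod_cast h

end Subfields


/-! ## §2 The census of partially-bent CM types of a multiquadratic CM field -/

section Census

omit [IsCMField K] in
/-- The twist form of partial bentness is the tree's group-level predicate on `T_Φ` (dictionary
`partiallyBent_iff_forall_ncard_inter` with `g = [K:ℚ]/2` evaluated). [cite: Carlet2020, §6.2.1 Definition 62]
[cite: Shimura1998, §8.2] -/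
private theorem setOf_twist_eq_pc (hexp : ∀ g : K ≃ₐ[ℚ] K, g ^ 2 = 1) (φ₀ : K →+* ℂ) {g : ℕ}
    (hg : finrank ℚ K / 2 = g) :
    {Φ : CMType K | ∀ σ : K ≃ₐ[ℚ] K,
      ((Φ.1 ∩ (inducedCMType (σ.symm : K →+* K) Φ).1).ncard = 0 ∨
        (Φ.1 ∩ (inducedCMType (σ.symm : K →+* K) Φ).1).ncard = g) ∨
      2 * (Φ.1 ∩ (inducedCMType (σ.symm : K →+* K) Φ).1).ncard = g} =
      {Φ : CMType K | ∀ g : K ≃ₐ[ℚ] K,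
        (((Finset.univ.filter fun s : K ≃ₐ[ℚ] K => embOf φ₀ s ∈ Φ.1).filter fun t =>
            t * g ∈ (Finset.univ.filter fun s : K ≃ₐ[ℚ] K => embOf φ₀ s ∈ Φ.1)).card = 0 ∨
          ((Finset.univ.filter fun s : K ≃ₐ[ℚ] K => embOf φ₀ s ∈ Φ.1).filter fun t =>
            t * g ∈ (Finset.univ.filter fun s : K ≃ₐ[ℚ] K => embOf φ₀ s ∈ Φ.1)).card =
            (Finset.univ.filter fun s : K ≃ₐ[ℚ] K => embOf φ₀ s ∈ Φ.1).card) ∨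
        2 * ((Finset.univ.filter fun s : K ≃ₐ[ℚ] K => embOf φ₀ s ∈ Φ.1).filter fun t =>
            t * g ∈ (Finset.univ.filter fun s : K ≃ₐ[ℚ] K => embOf φ₀ s ∈ Φ.1)).card =
          (Finset.univ.filter fun s : K ≃ₐ[ℚ] K => embOf φ₀ s ∈ Φ.1).card} := by
  ext Φ
  simp only [Set.mem_setOf_eq]
  rw [partiallyBent_iff_forall_ncard_inter hexp φ₀ Φ, hg]

/-- **A MULTIQUADRATIC CM FIELD OF DEGREE `64` HAS EXACTLY `65 536 = 2¹⁶` CM TYPES ALL OF WHOSE GALOIS TWISTS MEET THEM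
IN `0`, `16` OR `32` EMBEDDINGS** (the partially-bent types; of `2³²` CM types in all).
[cite: Carlet2020, §6.2.1 Proposition 94 and Definition 62] [cite: Tokareva2015BentFunctions, §7.1]
[cite: CheboluLockridge2022, §2 Theorem 2.2] [cite: Shimura1998, §8.2 Proposition 26] -/
theorem ncard_partiallyBent_of_finrank_eq_sixtyFour (hexp : ∀ g : K ≃ₐ[ℚ] K, g ^ 2 = 1) (hK : finrank ℚ K = 64) :
    {Φ : CMType K | ∀ σ : K ≃ₐ[ℚ] K,
      ((Φ.1 ∩ (inducedCMType (σ.symm : K →+* K) Φ).1).ncard = 0 ∨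
        (Φ.1 ∩ (inducedCMType (σ.symm : K →+* K) Φ).1).ncard = 32) ∨
      2 * (Φ.1 ∩ (inducedCMType (σ.symm : K →+* K) Φ).1).ncard = 32}.ncard = 65536 := by
  obtain ⟨φ₀⟩ := (inferInstance : Nonempty (K →+* ℂ))
  haveI := Multiquadratic.isAbelianGalois_of_forall_sq_eq_one hexp
  rw [setOf_twist_eq_pc hexp φ₀ (by rw [hK]), ncard_eq_card_filter_pc hexp φ₀ (fun T : Finset (K ≃ₐ[ℚ] K) =>
    ∀ g : K ≃ₐ[ℚ] K, ((T.filter fun t => t * g ∈ T).card = 0 ∨ (T.filter fun t => t * g ∈ T).card = T.card) ∨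
      2 * (T.filter fun t => t * g ∈ T).card = T.card)]
  have h64 : Fintype.card (K ≃ₐ[ℚ] K) = 64 := by rw [card_gal_eq_finrank φ₀, hK]
  convert card_filter_partiallyBent_of_card_eq_sixtyFour hexp (conjGalElt_ne_one (apply_conjGal_eq_pc φ₀)) h64 using 3

/-- **BY THE ORDER OF THE STABILISER (degree `64`)**: `64` such types with `|Stab(Φ)| = 32` (reflex-type field
imaginary quadratic: `Φ` induced from one of the `32` imaginary quadratic subfields, two types each), `9 920` with
`|Stab(Φ)| = 8` (reflex-type field one of the `1240` CM subfields of degree `8`, `8 = |𝓑₂|` types each, tree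
`ncard_partiallyBent_twistStabilizer_eq_of_finrank_eq_eight`), `55 552` with `|Stab(Φ)| = 2` (reflex-type field one of
the `62` CM subfields of degree `32`, `896 = |𝓑₄|` types each — the imprimitive near-bent types).
[cite: Tokareva2015BentFunctions, §7.1] [cite: Carlet2020, §6.2.1 Proposition 94 and Definition 62]
[cite: Shimura1998, §8.2 Proposition 26 and §8.4 Example (1)] -/
theorem ncard_partiallyBent_natCard_twistStabilizer_of_finrank_eq_sixtyFour (hexp : ∀ g : K ≃ₐ[ℚ] K, g ^ 2 = 1)
    (hK : finrank ℚ K = 64) :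
    {Φ : CMType K | (∀ σ : K ≃ₐ[ℚ] K,
      ((Φ.1 ∩ (inducedCMType (σ.symm : K →+* K) Φ).1).ncard = 0 ∨
        (Φ.1 ∩ (inducedCMType (σ.symm : K →+* K) Φ).1).ncard = 32) ∨
      2 * (Φ.1 ∩ (inducedCMType (σ.symm : K →+* K) Φ).1).ncard = 32) ∧
      Nat.card (twistStabilizer Φ) = 32}.ncard = 64 ∧
    {Φ : CMType K | (∀ σ : K ≃ₐ[ℚ] K,
      ((Φ.1 ∩ (inducedCMType (σ.symm : K →+* K) Φ).1).ncard = 0 ∨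
        (Φ.1 ∩ (inducedCMType (σ.symm : K →+* K) Φ).1).ncard = 32) ∨
      2 * (Φ.1 ∩ (inducedCMType (σ.symm : K →+* K) Φ).1).ncard = 32) ∧
      Nat.card (twistStabilizer Φ) = 8}.ncard = 9920 ∧
    {Φ : CMType K | (∀ σ : K ≃ₐ[ℚ] K,
      ((Φ.1 ∩ (inducedCMType (σ.symm : K →+* K) Φ).1).ncard = 0 ∨
        (Φ.1 ∩ (inducedCMType (σ.symm : K →+* K) Φ).1).ncard = 32) ∨
      2 * (Φ.1 ∩ (inducedCMType (σ.symm : K →+* K) Φ).1).ncard = 32) ∧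
      Nat.card (twistStabilizer Φ) = 2}.ncard = 55552 := by
  obtain ⟨φ₀⟩ := (inferInstance : Nonempty (K →+* ℂ))
  haveI := Multiquadratic.isAbelianGalois_of_forall_sq_eq_one hexp
  have h64 : Fintype.card (K ≃ₐ[ℚ] K) = 64 := by rw [card_gal_eq_finrank φ₀, hK]
  have hg : finrank ℚ K / 2 = 32 := by rw [hK]
  obtain ⟨h32, h8, h2⟩ := card_filter_partiallyBent_card_stabilizer_of_card_eq_sixtyFour hexp
    (conjGalElt_ne_one (apply_conjGal_eq_pc φ₀)) h64
  have hset : ∀ n : ℕ, {Φ : CMType K | (∀ σ : K ≃ₐ[ℚ] K,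
      ((Φ.1 ∩ (inducedCMType (σ.symm : K →+* K) Φ).1).ncard = 0 ∨
        (Φ.1 ∩ (inducedCMType (σ.symm : K →+* K) Φ).1).ncard = 32) ∨
      2 * (Φ.1 ∩ (inducedCMType (σ.symm : K →+* K) Φ).1).ncard = 32) ∧
      Nat.card (twistStabilizer Φ) = n} =
      {Φ : CMType K | (∀ g : K ≃ₐ[ℚ] K,
        (((Finset.univ.filter fun s : K ≃ₐ[ℚ] K => embOf φ₀ s ∈ Φ.1).filter fun t =>
            t * g ∈ (Finset.univ.filter fun s : K ≃ₐ[ℚ] K => embOf φ₀ s ∈ Φ.1)).card = 0 ∨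
          ((Finset.univ.filter fun s : K ≃ₐ[ℚ] K => embOf φ₀ s ∈ Φ.1).filter fun t =>
            t * g ∈ (Finset.univ.filter fun s : K ≃ₐ[ℚ] K => embOf φ₀ s ∈ Φ.1)).card =
            (Finset.univ.filter fun s : K ≃ₐ[ℚ] K => embOf φ₀ s ∈ Φ.1).card) ∨
        2 * ((Finset.univ.filter fun s : K ≃ₐ[ℚ] K => embOf φ₀ s ∈ Φ.1).filter fun t =>
            t * g ∈ (Finset.univ.filter fun s : K ≃ₐ[ℚ] K => embOf φ₀ s ∈ Φ.1)).card =
          (Finset.univ.filter fun s : K ≃ₐ[ℚ] K => embOf φ₀ s ∈ Φ.1).card) ∧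
      Nat.card (twistStabilizer Φ) = n} := by
    intro n
    ext Φ
    simp only [Set.mem_setOf_eq]
    rw [partiallyBent_iff_forall_ncard_inter hexp φ₀ Φ, hg]
  refine ⟨?_, ?_, ?_⟩
  · rw [hset 32, ncard_eq_card_filter_stab_pc hexp φ₀ (fun T : Finset (K ≃ₐ[ℚ] K) =>
    ∀ g : K ≃ₐ[ℚ] K, ((T.filter fun t => t * g ∈ T).card = 0 ∨ (T.filter fun t => t * g ∈ T).card = T.card) ∨
      2 * (T.filter fun t => t * g ∈ T).card = T.card) 32]
    convert h32 using 3
  · rw [hset 8, ncard_eq_card_filter_stab_pc hexp φ₀ (fun T : Finset (K ≃ₐ[ℚ] K) =>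
    ∀ g : K ≃ₐ[ℚ] K, ((T.filter fun t => t * g ∈ T).card = 0 ∨ (T.filter fun t => t * g ∈ T).card = T.card) ∨
      2 * (T.filter fun t => t * g ∈ T).card = T.card) 8]
    convert h8 using 3
  · rw [hset 2, ncard_eq_card_filter_stab_pc hexp φ₀ (fun T : Finset (K ≃ₐ[ℚ] K) =>
    ∀ g : K ≃ₐ[ℚ] K, ((T.filter fun t => t * g ∈ T).card = 0 ∨ (T.filter fun t => t * g ∈ T).card = T.card) ∨
      2 * (T.filter fun t => t * g ∈ T).card = T.card) 2]
    convert h2 using 3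

/-- **DEGREE `32`: EXACTLY `2048 = 2¹¹` CM types with `|Φ ∩ Φσ| ∈ {0, 8, 16}` for every `σ`** (of `65 536`).
[cite: Carlet2020, §6.2.1 Proposition 94 and Definition 62] [cite: Tokareva2015BentFunctions, §7.1]
[cite: CheboluLockridge2022, §2 Theorem 2.2] -/
theorem ncard_partiallyBent_of_finrank_eq_thirtyTwo (hexp : ∀ g : K ≃ₐ[ℚ] K, g ^ 2 = 1) (hK : finrank ℚ K = 32) :
    {Φ : CMType K | ∀ σ : K ≃ₐ[ℚ] K,
      ((Φ.1 ∩ (inducedCMType (σ.symm : K →+* K) Φ).1).ncard = 0 ∨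
        (Φ.1 ∩ (inducedCMType (σ.symm : K →+* K) Φ).1).ncard = 16) ∨
      2 * (Φ.1 ∩ (inducedCMType (σ.symm : K →+* K) Φ).1).ncard = 16}.ncard = 2048 := by
  obtain ⟨φ₀⟩ := (inferInstance : Nonempty (K →+* ℂ))
  haveI := Multiquadratic.isAbelianGalois_of_forall_sq_eq_one hexp
  rw [setOf_twist_eq_pc hexp φ₀ (by rw [hK]), ncard_eq_card_filter_pc hexp φ₀ (fun T : Finset (K ≃ₐ[ℚ] K) =>
    ∀ g : K ≃ₐ[ℚ] K, ((T.filter fun t => t * g ∈ T).card = 0 ∨ (T.filter fun t => t * g ∈ T).card = T.card) ∨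
      2 * (T.filter fun t => t * g ∈ T).card = T.card)]
  have h32 : Fintype.card (K ≃ₐ[ℚ] K) = 32 := by rw [card_gal_eq_finrank φ₀, hK]
  convert card_filter_partiallyBent_of_card_eq_thirtyTwo hexp (conjGalElt_ne_one (apply_conjGal_eq_pc φ₀)) h32 using 3

/-- **DEGREE `16`: EXACTLY `128 = 2⁷` CM types with `|Φ ∩ Φσ| ∈ {0, 4, 8}` for every `σ`** (of `256`; the other `128`
are the CM types of rank `4`). [cite: Carlet2020, §6.2.1 Proposition 94 and Definition 62] [cite: Tokareva2015BentFunctions, §7.1]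
[cite: CheboluLockridge2022, §2 Theorem 2.2] -/
theorem ncard_partiallyBent_of_finrank_eq_sixteen (hexp : ∀ g : K ≃ₐ[ℚ] K, g ^ 2 = 1) (hK : finrank ℚ K = 16) :
    {Φ : CMType K | ∀ σ : K ≃ₐ[ℚ] K,
      ((Φ.1 ∩ (inducedCMType (σ.symm : K →+* K) Φ).1).ncard = 0 ∨
        (Φ.1 ∩ (inducedCMType (σ.symm : K →+* K) Φ).1).ncard = 8) ∨
      2 * (Φ.1 ∩ (inducedCMType (σ.symm : K →+* K) Φ).1).ncard = 8}.ncard = 128 := by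
  obtain ⟨φ₀⟩ := (inferInstance : Nonempty (K →+* ℂ))
  haveI := Multiquadratic.isAbelianGalois_of_forall_sq_eq_one hexp
  rw [setOf_twist_eq_pc hexp φ₀ (by rw [hK]), ncard_eq_card_filter_pc hexp φ₀ (fun T : Finset (K ≃ₐ[ℚ] K) =>
    ∀ g : K ≃ₐ[ℚ] K, ((T.filter fun t => t * g ∈ T).card = 0 ∨ (T.filter fun t => t * g ∈ T).card = T.card) ∨
      2 * (T.filter fun t => t * g ∈ T).card = T.card)]
  have h16 : Fintype.card (K ≃ₐ[ℚ] K) = 16 := by rw [card_gal_eq_finrank φ₀, hK]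
  convert card_filter_partiallyBent_of_card_eq_sixteen hexp (conjGalElt_ne_one (apply_conjGal_eq_pc φ₀)) h16 using 3

/-- **DEGREE `8` (`K = ℚ(√−d, √a, √b)` CM): EVERY CM type `Φ` has `|Φ ∩ Φσ| ∈ {0, 2, 4}` for every `σ`** — all `16`
CM types of an octic multiquadratic CM field are partially-bent (every Boolean function of `2` variables is affine or
bent). [cite: Carlet2020, §6.2.1 Proposition 94 and Definition 62] [cite: Tokareva2015BentFunctions, §7.1] -/
theorem forall_partiallyBent_of_finrank_eq_eight (hexp : ∀ g : K ≃ₐ[ℚ] K, g ^ 2 = 1) (hK : finrank ℚ K = 8)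
    (Φ : CMType K) (σ : K ≃ₐ[ℚ] K) :
    ((Φ.1 ∩ (inducedCMType (σ.symm : K →+* K) Φ).1).ncard = 0 ∨
        (Φ.1 ∩ (inducedCMType (σ.symm : K →+* K) Φ).1).ncard = 4) ∨
      2 * (Φ.1 ∩ (inducedCMType (σ.symm : K →+* K) Φ).1).ncard = 4 := by
  obtain ⟨φ₀⟩ := (inferInstance : Nonempty (K →+* ℂ))
  haveI := Multiquadratic.isAbelianGalois_of_forall_sq_eq_one hexp
  have h8 : Fintype.card (K ≃ₐ[ℚ] K) = 8 := by rw [card_gal_eq_finrank φ₀, hK]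
  have hg : finrank ℚ K / 2 = 4 := by rw [hK]
  have h := (partiallyBent_iff_forall_ncard_inter hexp φ₀ Φ).1 (fun g =>
    forall_partiallyBent_of_card_eq_eight hexp (conjGalElt_ne_one (apply_conjGal_eq_pc φ₀)) h8
      (CyclicTwoOddPrimes.isCMTypeWith_galType (apply_conjGal_eq_pc φ₀) Φ) g) σ
  rw [hg] at h
  exact h

end Census

/-! ## §3 The Hodge conjecture for all powers: at least `2¹⁶` of the `2³²` CM types -/

section Hodge

/-- **AT LEAST `65 536` OF THE `2³²` CM TYPES OF A DEGREE-`64` MULTIQUADRATIC CM FIELD HAVE THE PROPERTY THAT EVERY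
ABELIAN VARIETY OF THAT TYPE SATISFIES THE HODGE CONJECTURE TOGETHER WITH ALL ITS POWERS** (the partially-bent ones;
tree `hodgeConjectureFor_pow_of_forall_ncard_inter`). [cite: Gordon1999HodgeAVSurvey, Thm. 6.4 and §9.3]
[cite: Pohlmann1968, Thm. 1] [cite: Carlet2020, §6.2.1 Proposition 94 and Definition 62] [cite: Tokareva2015BentFunctions, §7.1] -/
theorem le_ncard_forall_hodgeConjectureFor_pow_of_finrank_eq_sixtyFour (hexp : ∀ g : K ≃ₐ[ℚ] K, g ^ 2 = 1)
    (hK : finrank ℚ K = 64) :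
    65536 ≤ {Φ : CMType K | ∀ (A : AbelianVariety ℂ) (ι : 𝓞 K →+* End A)
      (θ : K →+* Module.End ℂ (complexBetti A.X 1)), IsCMTypeRealisation Φ A ι θ →
        ∀ n : ℕ, HodgeConjectureFor (⨁ fun _ : Fin n => A).dim (⨁ fun _ : Fin n => A).X}.ncard := by
  haveI := finite_cmType_pc (K := K)
  rw [← ncard_partiallyBent_of_finrank_eq_sixtyFour hexp hK]
  refine Set.ncard_le_ncard (fun Φ hΦ A ι θ hA => ?_) (Set.toFinite _)
  have hg : finrank ℚ K / 2 = 32 := by rw [hK]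
  have hΦ' : ∀ σ : K ≃ₐ[ℚ] K,
      ((Φ.1 ∩ (inducedCMType (σ.symm : K →+* K) Φ).1).ncard = 0 ∨
        (Φ.1 ∩ (inducedCMType (σ.symm : K →+* K) Φ).1).ncard = finrank ℚ K / 2) ∨
      2 * (Φ.1 ∩ (inducedCMType (σ.symm : K →+* K) Φ).1).ncard = finrank ℚ K / 2 := by
    rw [hg]; exact hΦ
  exact (hodgeConjectureFor_pow_of_forall_ncard_inter hexp Φ hΦ' hA).2

/-- The same with `Bᵐ(A) ⊗ ℂ = Dᵐ(A) ⊗ ℂ` for all `m` (Hodge classes of every codimension on `A` itself are spanned by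
products of divisor classes). [cite: Gordon1999HodgeAVSurvey, Thm. 6.4] [cite: Pohlmann1968, Thm. 1]
[cite: Carlet2020, §6.2.1 Proposition 94 and Definition 62] -/
theorem le_ncard_forall_hodgeClassSpan_eq_of_finrank_eq_sixtyFour (hexp : ∀ g : K ≃ₐ[ℚ] K, g ^ 2 = 1)
    (hK : finrank ℚ K = 64) :
    65536 ≤ {Φ : CMType K | ∀ (A : AbelianVariety ℂ) (ι : 𝓞 K →+* End A)
      (θ : K →+* Module.End ℂ (complexBetti A.X 1)), IsCMTypeRealisation Φ A ι θ →
        ∀ m : ℕ, Literature.AlgebraicGeometry.VanGeemen1994.hodgeClassSpan 32 A.X m =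
          Literature.Barriers.HodgeConjecture.divisorClassesSpan A.X 32 m}.ncard := by
  haveI := finite_cmType_pc (K := K)
  rw [← ncard_partiallyBent_of_finrank_eq_sixtyFour hexp hK]
  refine Set.ncard_le_ncard (fun Φ hΦ A ι θ hA => ?_) (Set.toFinite _)
  have hg : finrank ℚ K / 2 = 32 := by rw [hK]
  have hΦ' : ∀ σ : K ≃ₐ[ℚ] K,
      ((Φ.1 ∩ (inducedCMType (σ.symm : K →+* K) Φ).1).ncard = 0 ∨
        (Φ.1 ∩ (inducedCMType (σ.symm : K →+* K) Φ).1).ncard = finrank ℚ K / 2) ∨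
      2 * (Φ.1 ∩ (inducedCMType (σ.symm : K →+* K) Φ).1).ncard = finrank ℚ K / 2 := by
    rw [hg]; exact hΦ
  have h := (hodgeConjectureFor_pow_of_forall_ncard_inter hexp Φ hΦ' hA).1
  rw [hg] at h
  exact h

end Hodge

end MultiquadraticPartiallyBentCensus

end Literature.AlgebraicGeometry.Pohlmann1968
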